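import Summits.CriticalPhenomena.CardyFormulaZ2.Theses.CardySelfRefinement
import Summits.CriticalPhenomena.CardyFormulaZ2.Theorems.CardySelfRefinementLagHandOffTranslation
import Summits.CriticalPhenomena.CardyFormulaZ2.Theorems.LagHandOff.Negative.Structure
import Literature.Probability.Percolation.QuadCrossingContinuityOfLemma51
import HarnessLib.Audit

/-!
# Line `hitting-tournament` — skeleton for crux `CardySelfRefinement.LagHandOff`
(item stmt-CriticalPhenomena-10268, route route-CriticalPhenomena-CardySelfRefinement)

LEAD-OWNED copy (prover-line-stmt-CriticalPhenomena-10268-1, picked 2026-08-16).  Changes to the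
planner's skeleton: (a) `stub_translationInvariance` is the landed theorem
`CrosscutDictionary.stub_translationInput` (p71750, identical statement) — imported, no longer a
stub; (b) clause (i) is the disprover's landed `Negative.lagHandOff_clause_i` — imported, the
verbatim copy is deleted; (c) the registered stubs `stub_quadContinuity`,
`stub_limitCurveRegularity`, `stub_tournamentRigidity` are stated in TREE VOCABULARY (the line's
`def`s unfolded) so that a worker's `Theorems/` file proves literally the registered signature
(the `def`s of this file are not importable from `Theorems/`); the line vocabulary is kept and the
named forms `quadContinuity`, `limitCurveRegularity`, `tournamentRigidity` are one-line
consequences; (d) `stub_tournamentTransfer`, `stub_markovLocality` unchanged (line vocabulary).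

Idea (crux idea card `hitting-tournament`, ideator 1, evidence 20260815T224630Z; triage r1-1/2/3 pass):
the first-hitting data of the exploration interface on cross-cuts of the domain — WHICH cross-cut
is hit first, and WHERE — are (Boolean combinations of) quad-crossing events (Holden–Sun
arXiv:1905.13207 §6.6, Prop. 6.25, pp. 108–110, step (1): "η(τ) ∈ ρ([0,s]) iff ω(Q) = 1,
Q = (U; −i, ρ(1), ρ(s), ρ(0))"; exact on the lattice, `kit` j006763 identity I3, 0 failures).
A curve that never idles inside its past range is determined, modulo reparametrisation, by this
"hitting tournament" over a countable separating family (`TournamentRigidity`, deterministic).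
Hence along ANY sequence of meshes on which the full-plane quad-crossing laws converge to `μ`,
the interface of EVERY Dobrushin domain and EVERY admissible discretisation converges, jointly
with the configuration, to `Ψ D (S)`, `S ∼ μ`, for ONE Borel, similarity-equivariant,
domain-reading decoder `Ψ` (`IsTournamentTransfer`, the transfer `C⁺`, pathwise and E-blind —
strictly stronger than clause (ii) and the reason one subsequence serves all `(D, E)`).
The family `P D := (Ψ D)_* μ` is then chordal and non-boundary-tracing (limit-curve regularity),
similarity covariant by a push-forward computation that is LINEAR in the crux's two antecedents
(rotations: `RotationInput`; dilations: `ScaleInvariantLimits`) plus translation invariance of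
subsequential limits (`stub_translationInvariance`), and domain-Markov / local / target-independent
by the stopping-set passage (`stub_markovLocality`, the tree's set-based axioms).

## Stubs (6) and glue

* `stub_translationInvariance` (M) — subsequential quad-crossing limits of bond-`ℤ²` are
  translation invariant (lattice translations `z2QuadLaw_map_translate_meshPoint` + joint
  continuity of the translation action on the compact `ℋ_ℂ`).
* `stub_quadContinuity` (L) — crossing events `⊞_Q` are continuity events of every subsequential
  limit on `ℋ_ℂ` (the `univ` instance of the tree's named fact `SchrammSmirnov2011_lemma_5_1`,
  already reduced in tree to a uniform arm bound): the tournament bits pass to the limit.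
* `stub_limitCurveRegularity` (L) — every subsequential weak limit of interface laws of an
  admissible discretisation family is carried by chordal curves of `D̄` from `a` to `b` that trace
  no boundary arc and never idle inside their past range (RSW in boundary annuli; AB99/KS17).
* `stub_tournamentRigidity` (M/L, deterministic) — THE LEVER: two curves with the same source,
  no idling relative to a family `𝓕` of closed sets, and the same hitting tournament (first-hit
  ORDER on `𝓕 × 𝓕`, first-hit LOCATION against locators `𝓖` separating points of members of `𝓕`)
  define the same curve class.
* `stub_tournamentTransfer` (XL, load-bearing) — rigidity + regularity ⇒ a tournament transfer
  `Ψ` exists (HS19 Prop. 6.25 transplanted to `ℤ²` subsequential limits: dictionary = crossing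
  events of the quads `(W; a, x, y, z)` cut out by rational polygonal cross-cuts, continuity of
  these events under every subsequential limit (SS11 Lemma 5.1 / GPS13 §2, RSW only), joint
  tightness (`isTightLaws_map_bondInterface_holds`), identification by rigidity; equivariant
  all-`D` decoder by transport along similarity orbits).
* `stub_markovLocality` (XL, hardest) — a tournament transfer can be chosen so that every
  `P_μ = (Ψ ·)_* μ` is domain-Markov, local and target-independent (strong spatial Markov property
  of `μ` across stopping hulls + the transfer in interface-lined slit domains; `stopAt_mk`).
* Glue (sorry-free): `exists_quadLimit_subseq` (SS11 Cor. 1.6 along a given mesh sequence: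
  compactness of `ℋ_ℂ`, `QuadConfig.compactSpace`, Thm 1.4 `SchrammSmirnov2011_thm_1_4_holds`,
  Prokhorov on a compact space), `lagHandOff_clause_i` (clause (i) OUTRIGHT — verbatim from the
  adversary's `Cruxes/LagHandOff/Disproof.lean`, cdisprove cycle 1), the covariance computation
  `map_mapHomeomorph_similarity_eq` / `isSimilarityCovariant_lawFamily`, `isChordal_lawFamily`,
  `tendsto_integral_lawFamily`, and the composition `LagHandOff_of : LagHandOff`.

## Disproof.lean obligations honoured (cdisprove cycles 1–2, evidence notes on stmt-10268)

* `not_lagHandOff_iff` / `lagHandOff_iff_clauseII`: both antecedents are USED, and only where the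
  adversary located their load — `RotationInput` and `ScaleInvariantLimits` enter exactly once, in
  `map_mapHomeomorph_similarity_eq` (similarity covariance of `P` along ONE subsequence IS
  Euclidean + scale invariance of interface limits: g2's `not_clauseII_of_moved_incoherent`).
* `conclusion_false_without_discretisation_guard`, `conclusion_false_without_mesh_positivity`:
  both guards are threaded through `IsTournamentTransfer.jointLimit` and `LimitCurveRegularity`
  (`ZdDiscretisationFamily D E`, `∀ n, 0 < δs n`); no stub speaks about unguarded data.
* vacuity channels (`hyps_of_subseqQuadLimits_eq_empty/subset_zero`): closed in the tree and used
  here — `measurable_z2QuadConfig` / `isProbabilityMeasure_of_isSubseqQuadLimit` make every `μ` a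
  probability law and `exists_quadLimit_subseq` makes `Λ ≠ ∅`; so `P D = (Ψ D)_* μ` is a
  probability law (triage sharpening 2: "`Measurable configOf` first").
* `lagHandOff_clause_i`: reused verbatim (clause (i) is not a stub).
* `arcFamily_traces_boundary` (NoTrace has teeth): no-tracing is an explicit conjunct of
  `LimitCurveRegularity` and of `IsTournamentTransfer.chordal`, never assumed of `P` directly.
* `witness_unique_on_discretisable`, `isLocal_eq_of_carrier_eq`, `markov_empty` (g2): consistent —
  `Ψ D` is pinned `μ`-a.e. on discretisable `D` by `jointLimit`; `readsDomain` makes `Ψ D` blind to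
  everything but the quads of `D̄`; the `F = ∅` instance of the Markov axiom is the prover's
  convention `Ψ_(U; b, b) := const b` inside `stub_markovLocality`.
* No landed `Theorems/LagHandOff/Negative/` lemma exists (gate target not accepted); nothing to
  import. `ledger negatives --problem CriticalPhenomena`: no refuted statement is restated.
-/

noncomputable section

open MeasureTheory Filter Set Topology
open scoped unitInterval BoundedContinuousFunction
open Literature.Probability.Percolation Literature.Probability.LatticeModels
open Literature.Probability.RandomPlanarGeometry Literature.Probability.Percolation.QuadCrossing
open Summit.CriticalPhenomena.CardyFormulaZ2.Theses.CardySelfRefinement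

namespace Summit.CriticalPhenomena.CardyFormulaZ2.Cruxes.LagHandOff.HittingTournament

/-! ## Vocabulary of the line (transparent definitions over tree declarations) -/

/-- "A.s. no boundary tracing" at one curve class (the clause of `LagHandOff` (ii), verbatim; same
as `Cruxes.LagHandOff.Disproof.NoTraceAt`). -/
@[folklore] def NoTraceAt (D : DobrushinDomain) (γ : CurveClass ℂ) : Prop :=
  ∀ c : Curve ℂ, CurveClass.mk c = γ → ∀ s t : I, s < t →
    c '' Set.Icc s t ⊆ frontier D.carrier → (c '' Set.Icc s t).Subsingleton

/-- The class `γ` NEVER IDLES INSIDE ITS PAST RANGE: every representative is, on every parameter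
interval, either constant or visits a point it has not visited before (KS17-type regularity of
Loewner curves: filled hulls strictly increase; here only the range version is used). -/
@[folklore] def NoIdleAt (γ : CurveClass ℂ) : Prop :=
  ∀ c : Curve ℂ, CurveClass.mk c = γ → ∀ s t : I, s < t →
    (∀ u ∈ Set.Icc s t, c u = c s) ∨ ∃ u ∈ Set.Ioo s t, c u ∉ c '' Set.Icc 0 s

/-- `γ` is a chordal curve of `(D; a, b)`: from `a` to `b` inside `D̄` (the `IsChordal` clause). -/
@[folklore] def IsChordalIn (D : DobrushinDomain) (γ : CurveClass ℂ) : Prop :=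
  γ.source = D.pt 0 ∧ γ.target = D.pt 1 ∧ γ.range ⊆ closure D.carrier

/-- The point where the curve `c` first hits the set `F` (its endpoint `c 1` if it never does;
`Curve.hitParam`). -/
def hitPoint (c : Curve ℂ) (F : Set ℂ) : ℂ := c ⟨c.hitParam F, c.hitParam_mem_Icc F⟩

/-- **The hitting tournament.** Two curves have the SAME TOURNAMENT over targets `𝓕` and locators
`𝓖` if (order) for all `F, F' ∈ 𝓕` they first hit `F` no later than `F'` simultaneously, and
(location) for all `F ∈ 𝓕` and locators `G ∈ 𝓖`, `G ⊆ F`, their first-hitting points of `F` lie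
in `G` simultaneously.  (In the line: `𝓕` = rational polygonal cross-cuts of `D`, `𝓖` = their
closed rational sub-arcs; each bit is a Boolean combination of quad-crossing events, HS19 p. 109.) -/
@[folklore] def SameTournament (𝓕 𝓖 : Set (Set ℂ)) (c₁ c₂ : Curve ℂ) : Prop :=
  (∀ F ∈ 𝓕, ∀ F' ∈ 𝓕, (c₁.hitParam F ≤ c₁.hitParam F' ↔ c₂.hitParam F ≤ c₂.hitParam F')) ∧
  (∀ F ∈ 𝓕, ∀ G ∈ 𝓖, G ⊆ F → (hitPoint c₁ F ∈ G ↔ hitPoint c₂ F ∈ G))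

/-- The locators `𝓖` SEPARATE THE POINTS of every target: around every point `z` of every `F ∈ 𝓕`
there are arbitrarily small locators `G ⊆ F` containing a relative neighbourhood of `z` in `F`. -/
@[folklore] def LocSeparating (𝓕 𝓖 : Set (Set ℂ)) : Prop :=
  ∀ F ∈ 𝓕, ∀ z ∈ F, ∀ ε : ℝ, 0 < ε → ∃ G ∈ 𝓖, G ⊆ F ∧ G ⊆ Metric.closedBall z ε ∧
    ∃ V : Set ℂ, IsOpen V ∧ z ∈ V ∧ V ∩ F ⊆ G

/-- `c` does not idle RELATIVE TO `𝓕`: on every parameter interval it is constant or first-hits a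
new member of `𝓕` (for curves with `NoIdleAt`/`NoTraceAt` and `𝓕` the cross-cuts of `D` this is a
deterministic consequence, proved inside the transfer stub). -/
@[folklore] def NoIdleRel (𝓕 : Set (Set ℂ)) (c : Curve ℂ) : Prop :=
  ∀ s t : I, s < t → (∀ u ∈ Set.Icc s t, c u = c s) ∨
    ∃ F ∈ 𝓕, (s : ℝ) < c.hitParam F ∧ c.hitParam F < (t : ℝ)

/-- **Tournament rigidity** (the deterministic lever of the line): curves with the same source,
no idling relative to a family `𝓕` of closed targets, and the same hitting tournament over
`(𝓕, 𝓖)` with `𝓖` separating the points of the targets, are equal modulo reparametrisation. -/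
@[folklore] def TournamentRigidity : Prop :=
  ∀ 𝓕 𝓖 : Set (Set ℂ), (∀ F ∈ 𝓕, IsClosed F) → LocSeparating 𝓕 𝓖 →
    ∀ c₁ c₂ : Curve ℂ, c₁.source = c₂.source → NoIdleRel 𝓕 c₁ → NoIdleRel 𝓕 c₂ →
      SameTournament 𝓕 𝓖 c₁ c₂ → CurveClass.mk c₁ = CurveClass.mk c₂

/-- **Regularity of subsequential interface limits**: along any sequence of positive meshes
`δₙ → 0`, every weak limit `ν` of the laws of the bond interfaces of an admissible discretisation
family of `(D; a, b)` is carried by chordal curves of `D̄` from `a` to `b` that trace no boundary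
arc and never idle inside their past range. -/
@[folklore] def LimitCurveRegularity : Prop :=
  ∀ (D : DobrushinDomain) (E : ℝ → DiscreteDobrushin), ZdDiscretisationFamily D E →
    ∀ δs : ℕ → ℝ, (∀ n, 0 < δs n) → Tendsto δs atTop (𝓝 0) →
      ∀ (ν : Measure (CurveClass ℂ)) [IsProbabilityMeasure ν],
        (∀ f : CurveClass ℂ →ᵇ ℝ,
          Tendsto (fun n => ∫ ω, f (bondInterfaceIn D (E (δs n)) ω)
            ∂(bondPercolation (zdGraph 2) half)) atTop (𝓝 (∫ γ, f γ ∂ν))) →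
        ∀ᵐ γ ∂ν, IsChordalIn D γ ∧ NoTraceAt D γ ∧ NoIdleAt γ

/-- **Continuity of crossing events under subsequential limits** — the `ℋ_ℂ` instance of
Schramm–Smirnov 2011 Lemma 5.1 (tree: named fact `SchrammSmirnov2011_lemma_5_1`, with the
reductions `SchrammSmirnov2011_lemma_5_1_of_continuity/_of_uniform/_of_bound` proved; see
`quadContinuity_of_lemma_5_1` below): every crossing event `⊞_Q` is a continuity event of every
subsequential scaling limit of bond-`ℤ²`.  The dictionary's tournament bits are finite Boolean
combinations of such events, so they pass to the limit (`measure_frontier_dnf_eq_zero`). -/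
@[folklore] def QuadContinuity : Prop :=
  ∀ μ ∈ subseqQuadLimits (univ : Set ℂ), ∀ Q : Quad (univ : Set ℂ),
    (μ : Measure (QuadConfig (univ : Set ℂ))) (frontier (QuadConfig.crossedEvent Q)) = 0

/-- **A tournament transfer** (the line's `C⁺`, "QuadDeterminesInterface"): ONE decoder
`Ψ : (D; a, b) ↦ (ℋ_ℂ → CurveClass ℂ)`, Borel in the configuration, reading only the quads of
`D̄`, exactly equivariant under similarities, such that (joint limit) whenever the full-plane laws
`μ_{δₙ}` of bond-`ℤ²` converge to `μ` along positive meshes `δₙ → 0`, for EVERY Dobrushin domain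
and EVERY admissible discretisation family the pair (configuration, interface) converges in law to
`(S, Ψ D S)`, `S ∼ μ` — the interface is asymptotically a deterministic function of the
quad-crossing configuration, the same function for all `E` — and (chordal) under every
subsequential limit the decoded curve of every `D` is a.s. chordal in `D` and traces no boundary
arc. -/
@[folklore] structure IsTournamentTransfer
    (Ψ : DobrushinDomain → QuadConfig (univ : Set ℂ) → CurveClass ℂ) : Prop where
  /-- Borel measurability in the configuration. -/
  measurable : ∀ D : DobrushinDomain, Measurable (Ψ D)
  /-- `Ψ D` reads the configuration only through the quads of `D̄`. -/
  readsDomain : ∀ (D : DobrushinDomain) (S S' : QuadConfig (univ : Set ℂ)),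
    (∀ Q : Quad (univ : Set ℂ), Q.carrier ⊆ closure D.carrier → (Q ∈ S ↔ Q ∈ S')) →
      Ψ D S = Ψ D S'
  /-- Exact equivariance under the orientation-preserving similarities `z ↦ c z + w`. -/
  equivariant : ∀ (D : DobrushinDomain) (c : ℂ) (hc : c ≠ 0) (w : ℂ)
    (S : QuadConfig (univ : Set ℂ)),
    Ψ (D.map (similarity c hc w)) (S.mapHomeomorph (similarity c hc w)) =
      (Ψ D S).map (similarity c hc w : C(ℂ, ℂ))
  /-- Joint convergence of (configuration, interface) to `(S, Ψ D S)` along every sequence of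
  positive meshes on which the full-plane quad-crossing laws converge, for all `(D, E)`. -/
  jointLimit : ∀ (δs : ℕ → ℝ) (μ : FiniteMeasure (QuadConfig (univ : Set ℂ))),
    (∀ n, 0 < δs n) → Tendsto δs atTop (𝓝 0) →
      Tendsto (fun n => z2QuadLaw univ (δs n)) atTop (𝓝 μ) →
        ∀ (D : DobrushinDomain) (E : ℝ → DiscreteDobrushin), ZdDiscretisationFamily D E →
          ∀ f : (QuadConfig (univ : Set ℂ) × CurveClass ℂ) →ᵇ ℝ,
            Tendsto (fun n => ∫ ω, f (z2QuadConfig univ (δs n) ω, bondInterfaceIn D (E (δs n)) ω)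
                ∂(bondPercolation (zdGraph 2) half)) atTop
              (𝓝 (∫ S, f (S, Ψ D S) ∂(μ : Measure (QuadConfig (univ : Set ℂ)))))
  /-- Under every subsequential limit the decoded curve is a.s. chordal in `D` and traces no
  boundary arc (for all `D`, discretisable or not). -/
  chordal : ∀ μ ∈ subseqQuadLimits (univ : Set ℂ), ∀ D : DobrushinDomain,
    ∀ᵐ γ ∂((μ : Measure (QuadConfig (univ : Set ℂ))).map (Ψ D)), IsChordalIn D γ ∧ NoTraceAt D γ

/-- The chordal family decoded from a law `μ` on `ℋ_ℂ`: `P D := (Ψ D)_* μ`. -/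
def lawFamily (μ : FiniteMeasure (QuadConfig (univ : Set ℂ)))
    (Ψ : DobrushinDomain → QuadConfig (univ : Set ℂ) → CurveClass ℂ) : ChordalFamily :=
  fun D => (μ : Measure (QuadConfig (univ : Set ℂ))).map (Ψ D)

/-! ## Stubs (registered open lemmas of the line) and the landed ones -/

/-- **(Landed) translation invariance of subsequential limits (`TranslationInput`).** Every
subsequential scaling limit `μ ∈ Λ` of the bond-`ℤ²` quad-crossing laws is invariant under all
translations `S ↦ w + S` of `ℋ_ℂ` — the theorem `CrosscutDictionary.stub_translationInput`
(Theorems/CardySelfRefinementLagHandOffTranslation.lean, p71750: exact `δℤ²`-invariance + joint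
continuity of the translation action on the compact `ℋ_ℂ`). -/
theorem translationInvariance :
    ∀ μ ∈ subseqQuadLimits (univ : Set ℂ), ∀ w : ℂ, μ.map (QuadConfig.translate w) = μ :=
  CrosscutDictionary.stub_translationInput

/-- **Stub 2 — crossing events are continuity events (SS11 Lemma 5.1 on `ℋ_ℂ`)**, registered in
tree vocabulary (= `QuadContinuity` unfolded).  It is the `univ` instance of the tree's NAMED FACT
`SchrammSmirnov2011_lemma_5_1` (`quadContinuity_of_lemma_5_1`), itself reduced in tree to the
scale-free Lemma 6.1 bound (`SchrammSmirnov2011_lemma_5_1_of_bound`; tame cases proved in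
`QuadCrossingContinuityTame.lean`).  Size L; shared with every `ℋ`-based route. -/
theorem stub_quadContinuity :
    ∀ μ ∈ subseqQuadLimits (univ : Set ℂ), ∀ Q : Quad (univ : Set ℂ),
      (μ : Measure (QuadConfig (univ : Set ℂ))) (frontier (QuadConfig.crossedEvent Q)) = 0 := by
  sorry

/-- Stub 2 in line vocabulary. -/
theorem quadContinuity : QuadContinuity := stub_quadContinuity

/-- **Stub 3 — regularity of subsequential interface limits**, registered in tree vocabulary
(= `LimitCurveRegularity` unfolded): along positive meshes `δₙ → 0`, every weak limit `ν` of the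
interface laws of an admissible discretisation family of `(D; a, b)` is carried by curve classes
that are chordal in `D̄` from `a` to `b`, trace no boundary arc (the crux's clause verbatim) and
never idle inside their past range.  Endpoints/range from admissibility; no-trace by boundary
arm events in the (rough) Jordan domain; no-idle = AB99/KS17 regularity (6 arms > α₅ = 2).
Size L/XL. -/
theorem stub_limitCurveRegularity :
    ∀ (D : DobrushinDomain) (E : ℝ → DiscreteDobrushin), ZdDiscretisationFamily D E →
      ∀ δs : ℕ → ℝ, (∀ n, 0 < δs n) → Tendsto δs atTop (𝓝 0) →
        ∀ (ν : Measure (CurveClass ℂ)) [IsProbabilityMeasure ν],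
          (∀ f : CurveClass ℂ →ᵇ ℝ,
            Tendsto (fun n => ∫ ω, f (bondInterfaceIn D (E (δs n)) ω)
              ∂(bondPercolation (zdGraph 2) half)) atTop (𝓝 (∫ γ, f γ ∂ν))) →
          ∀ᵐ γ ∂ν, (γ.source = D.pt 0 ∧ γ.target = D.pt 1 ∧ γ.range ⊆ closure D.carrier) ∧
            (∀ c : Curve ℂ, CurveClass.mk c = γ → ∀ s t : I, s < t →
              c '' Set.Icc s t ⊆ frontier D.carrier → (c '' Set.Icc s t).Subsingleton) ∧
            (∀ c : Curve ℂ, CurveClass.mk c = γ → ∀ s t : I, s < t →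
              (∀ u ∈ Set.Icc s t, c u = c s) ∨ ∃ u ∈ Set.Ioo s t, c u ∉ c '' Set.Icc 0 s) := by
  sorry

/-- Stub 3 in line vocabulary. -/
theorem limitCurveRegularity : LimitCurveRegularity := stub_limitCurveRegularity

/-- **Stub 4 — tournament rigidity (the lever, deterministic)**, registered in tree vocabulary
(= `TournamentRigidity` unfolded): two curves with the same source, no idling relative to a
family `𝓕` of closed targets (every parameter interval is constant or contains a first-hit time in
its interior), and the same hitting tournament over `(𝓕, 𝓖)` — first-hit ORDER bits on `𝓕 × 𝓕`
and first-hit LOCATION bits "the first-hit point of `F` lies in `G`" for `G ∈ 𝓖`, `G ⊆ F` —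
with `𝓖` separating the points of every target, define the same curve class.  Proof plan: the
hit/no-hit status and the first-hit points are tournament invariants (location bits +
separation); `T₁F ↦ T₂F` is an order isomorphism between the two hit-time sets carrying `c₁` to
`c₂`; both curves are constant on the gaps of (the closures of) these sets; piecewise-linear
interpolation of the isomorphism through finitely many hit times gives reparametrisations with
uniformly small error, so `dist c₁ c₂ = 0`, i.e. `mk c₁ = mk c₂` (separation quotient).
Size M/L. -/
theorem stub_tournamentRigidity :
    ∀ 𝓕 𝓖 : Set (Set ℂ), (∀ F ∈ 𝓕, IsClosed F) →
      (∀ F ∈ 𝓕, ∀ z ∈ F, ∀ ε : ℝ, 0 < ε → ∃ G ∈ 𝓖, G ⊆ F ∧ G ⊆ Metric.closedBall z ε ∧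
        ∃ V : Set ℂ, IsOpen V ∧ z ∈ V ∧ V ∩ F ⊆ G) →
      ∀ c₁ c₂ : Curve ℂ, c₁.source = c₂.source →
        (∀ s t : I, s < t → (∀ u ∈ Set.Icc s t, c₁ u = c₁ s) ∨
          ∃ F ∈ 𝓕, (s : ℝ) < c₁.hitParam F ∧ c₁.hitParam F < (t : ℝ)) →
        (∀ s t : I, s < t → (∀ u ∈ Set.Icc s t, c₂ u = c₂ s) ∨
          ∃ F ∈ 𝓕, (s : ℝ) < c₂.hitParam F ∧ c₂.hitParam F < (t : ℝ)) →
        ((∀ F ∈ 𝓕, ∀ F' ∈ 𝓕,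
            (c₁.hitParam F ≤ c₁.hitParam F' ↔ c₂.hitParam F ≤ c₂.hitParam F')) ∧
          (∀ F ∈ 𝓕, ∀ G ∈ 𝓖, G ⊆ F →
            (c₁ ⟨c₁.hitParam F, c₁.hitParam_mem_Icc F⟩ ∈ G ↔
              c₂ ⟨c₂.hitParam F, c₂.hitParam_mem_Icc F⟩ ∈ G))) →
        CurveClass.mk c₁ = CurveClass.mk c₂ := by
  sorry

/-- Stub 4 in line vocabulary. -/
theorem tournamentRigidity : TournamentRigidity := stub_tournamentRigidity

/-- **Stub 5 — the tournament transfer (load-bearing; HS19 Prop. 6.25 on `ℤ²` sublimits).**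
Continuity of crossing events (Stub 2), rigidity (Stub 4) and limit-curve regularity (Stub 3) give
a tournament transfer `Ψ`.  Why plausible / plan: fix for each similarity-orbit representative `D`
the countable family `𝓕_D` of rational polygonal cross-cuts and `𝓖_D` of their closed rational
sub-arcs (`LocSeparating`); (a) DICTIONARY: on the lattice each tournament bit of the exploration
path is exactly a Boolean combination of crossing events of the quads `(W; a, x, y, z)` cut out of
`D` by one or two cross-cuts (HS19 p. 109 step (1); `kit` j006763 I3, 0 failures; the bond-`ℤ²`
medial version is the same planar argument); (b) these quads are a.s. continuity quads of EVERY
subsequential limit (Stub 2; no near-miss of the division points by half-plane 3-arm bounds), so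
the bits converge jointly with `S_ω → S`; (c) joint tightness of (configuration, interface)
(`isTightLaws_map_bondInterface_holds`, compact `ℋ_ℂ`) and, for any joint sublimit `(S, γ)`, `γ` is
regular (Stub 3), hence `NoIdleRel 𝓕_D γ` (no-trace + no-idle, deterministic), and its tournament
equals the limit bits of `S`; (d) by `TournamentRigidity` (Stub 4) `γ` is the unique such class:
`γ = Ψ D S` a.s., so the joint limit is unique and the whole sequence converges, for every `E`;
(e) `Ψ` on the orbit `g • D` is defined by transport (exactly equivariant, reads only quads of
`g D̄`), and (a)–(d) are insensitive to which countable separating family is used, so `jointLimit`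
holds on the whole orbit; `chordal` for non-discretisable `D` is the intrinsic version of Stub 3
(the shared "all-`D`" residual; or a transported fixed chordal non-tracing access arc as junk
value).  Why it might fail: (b) at boundary-touching quads of rough Jordan domains; a.s.
consistency of the decoders of two separating families.  Size XL. -/
theorem stub_tournamentTransfer :
    QuadContinuity → TournamentRigidity → LimitCurveRegularity →
      ∃ Ψ : DobrushinDomain → QuadConfig (univ : Set ℂ) → CurveClass ℂ, IsTournamentTransfer Ψ := by
  sorry

/-- **Stub 6 — Markov / locality passage (hardest).** Given Stubs 2–4 (the inputs every decoding
argument uses), a tournament transfer can be re-chosen (off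
the `μ`-a.e.-pinned discretisable domains) so that for every subsequential limit `μ` the decoded
family `P_μ D = (Ψ D)_* μ` is domain-Markov (tree's set-based `IsMarkovExtension`: kernel
`Q D past :=` law under a FRESH `S̃ ∼ μ` of the decoder of the interface-lined remaining domain
`(remainingDomain D past; past.target, b)`, `domain`/`initial` by construction, `markov` = limit
of the exact lattice disintegration at the stopping hull, using spatial independence of `μ` over
disjoint regions and a.s. continuity of hull-sided quads, 6 arms > α₅ = 2), local in restriction
form and target independent (pathwise identities of decoders of nested / re-targeted domains up to
the stopping set, `readsDomain`, then push forward; needs measurability of `CurveClass.stopAt`,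
named fact `stopAt_mk`).  Why it might fail: the transfer must be extended to fractal slit domains
in Carathéodory-moving form (GPS13 p. 16; HS19 did this step by conformal invariance) — the one
place every surviving line can stall (triage r1-1 sharpening 1(c)).  Size XL. -/
theorem stub_markovLocality :
    QuadContinuity → TournamentRigidity → LimitCurveRegularity →
    ∀ Ψ : DobrushinDomain → QuadConfig (univ : Set ℂ) → CurveClass ℂ, IsTournamentTransfer Ψ →
      ∃ Ψ' : DobrushinDomain → QuadConfig (univ : Set ℂ) → CurveClass ℂ, IsTournamentTransfer Ψ' ∧
        ∀ μ ∈ subseqQuadLimits (univ : Set ℂ),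
          (lawFamily μ Ψ').IsDomainMarkov ∧ (lawFamily μ Ψ').IsLocal ∧
            (lawFamily μ Ψ').IsTargetIndependent := by
  sorry

/-! ## Glue (sorry-free) -/

/-! ### Subsequential quad-crossing limits along a given mesh sequence (SS11 Cor. 1.6) -/

/-- Along every sequence of positive meshes `δₙ → 0` some subsequence of the full-plane laws
`μ_{δₙ}` converges weakly, and the limit is a subsequential scaling limit (`ℋ_ℂ` is compact
metrizable Hausdorff — `QuadConfig.compactSpace`, `SchrammSmirnov2011_thm_1_4_holds` — so its
probability laws form a compact metrizable space; `measurable_z2QuadConfig` makes every `μ_δ` a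
probability law). -/
theorem exists_quadLimit_subseq (δs : ℕ → ℝ) (hpos : ∀ n, 0 < δs n)
    (hlim : Tendsto δs atTop (𝓝 0)) :
    ∃ φ : ℕ → ℕ, StrictMono φ ∧ ∃ μ : FiniteMeasure (QuadConfig (univ : Set ℂ)),
      μ ∈ subseqQuadLimits (univ : Set ℂ) ∧
        Tendsto (fun n => z2QuadLaw univ (δs (φ n))) atTop (𝓝 μ) := by
  haveI : T2Space (QuadConfig (univ : Set ℂ)) :=
    (SchrammSmirnov2011_thm_1_4_holds univ isOpen_univ univ_nonempty).1.2.2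
  haveI : CompactSpace (QuadConfig (univ : Set ℂ)) := QuadConfig.compactSpace
  haveI : TopologicalSpace.MetrizableSpace (QuadConfig (univ : Set ℂ)) :=
    (SchrammSmirnov2011_thm_1_4_holds univ isOpen_univ univ_nonempty).1.2.1
  haveI : TopologicalSpace.SeparableSpace (QuadConfig (univ : Set ℂ)) := by
    letI := TopologicalSpace.metrizableSpaceMetric (QuadConfig (univ : Set ℂ))
    infer_instance
  haveI hprob : ∀ n, IsProbabilityMeasure
      (z2QuadLaw univ (δs n) : Measure (QuadConfig (univ : Set ℂ))) :=
    fun n => isProbabilityMeasure_z2QuadLaw_of_pos isOpen_univ (hpos n)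
  let π : ℕ → ProbabilityMeasure (QuadConfig (univ : Set ℂ)) := fun n =>
    ⟨(z2QuadLaw univ (δs n) : Measure (QuadConfig (univ : Set ℂ))), hprob n⟩
  have hπF : ∀ n, (π n).toFiniteMeasure = z2QuadLaw univ (δs n) := fun n => rfl
  obtain ⟨πlim, -, φ, hφ, hlimπ⟩ := isCompact_univ.tendsto_subseq (x := π) fun n => mem_univ _
  have hconv : Tendsto (fun k => z2QuadLaw univ (δs (φ k))) atTop (𝓝 πlim.toFiniteMeasure) := by
    have := (ProbabilityMeasure.tendsto_nhds_iff_toFiniteMeasure_tendsto_nhds _).1 hlimπ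
    simpa only [Function.comp_def, hπF] using this
  refine ⟨φ, hφ, πlim.toFiniteMeasure, ?_, hconv⟩
  exact (isSubseqQuadLimit_iff univ _).2
    ⟨fun k => δs (φ k), fun k => hpos _, hlim.comp hφ.tendsto_atTop, hconv⟩

/-- Stub 2 is the `ℋ_ℂ` instance of the tree's named fact `SchrammSmirnov2011_lemma_5_1`. -/
theorem quadContinuity_of_lemma_5_1 (h : SchrammSmirnov2011_lemma_5_1) : QuadContinuity :=
  fun μ hμ Q => h univ isOpen_univ univ_nonempty μ hμ Q

/-! ### Clause (i): the disprover's landed theorem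

Clause (i) of `LagHandOff` (eventual a.e.-measurability of the interfaces of a discretisation
family) holds OUTRIGHT: `Summit.CriticalPhenomena.CardyFormulaZ2.Theorems.LagHandOff.Negative.lagHandOff_clause_i`
(Theorems/LagHandOff/Negative/Structure.lean, p72336). -/

/-! ### Similarity covariance is linear in the two antecedents (plus translations) -/

/-- **Where `RotationInput` and `ScaleInvariantLimits` are used.** A subsequential limit invariant
under rotations (`RotationInput`), dilations (`ScaleInvariantLimits`) and translations (Stub 1) is
invariant under every orientation-preserving similarity `z ↦ c z + w`:
`similarity c hc w = (rotation e^{i arg c}) ≫ (dilation ‖c‖) ≫ (translation w)`. -/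
theorem map_mapHomeomorph_similarity_eq (hRot : RotationInput) (hScale : ScaleInvariantLimits)
    (hTrans : ∀ μ ∈ subseqQuadLimits (univ : Set ℂ), ∀ w : ℂ, μ.map (QuadConfig.translate w) = μ)
    {μ : FiniteMeasure (QuadConfig (univ : Set ℂ))} (hμ : μ ∈ subseqQuadLimits (univ : Set ℂ))
    (c : ℂ) (hc : c ≠ 0) (w : ℂ) :
    (μ : Measure (QuadConfig (univ : Set ℂ))).map (QuadConfig.mapHomeomorph (similarity c hc w)) =
      μ := by
  have hnorm : (‖c‖ : ℝ) ≠ 0 := norm_ne_zero_iff.mpr hc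
  have hpos : 0 < ‖c‖ := norm_pos_iff.mpr hc
  -- the three generators
  let g₁ : ℂ ≃ₜ ℂ := (rotation (Circle.exp (Complex.arg c))).toIsometryEquiv.toHomeomorph
  let g₂ : ℂ ≃ₜ ℂ := Homeomorph.mulLeft₀ ((‖c‖ : ℝ) : ℂ) (Complex.ofReal_ne_zero.mpr hpos.ne')
  let g₃ : ℂ ≃ₜ ℂ := Homeomorph.addLeft w
  have hg₁ : ∀ z : ℂ, g₁ z = (Circle.exp (Complex.arg c) : ℂ) * z := fun z => rfl
  have hdecomp : similarity c hc w = (g₁.trans g₂).trans g₃ := by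
    refine Homeomorph.ext fun z => ?_
    rw [similarity_apply, Homeomorph.trans_apply, Homeomorph.trans_apply, hg₁]
    change c * z + w = w + ((‖c‖ : ℝ) : ℂ) * ((Circle.exp (Complex.arg c) : ℂ) * z)
    rw [Circle.coe_exp, ← mul_assoc, Complex.norm_mul_exp_arg_mul_I, add_comm]
  -- invariance under each generator
  have i₁ : (μ : Measure (QuadConfig (univ : Set ℂ))).map (QuadConfig.mapHomeomorph g₁) = μ := by
    have h := congrArg FiniteMeasure.toMeasure (hRot μ hμ (Complex.arg c))
    rw [isometryLaw, FiniteMeasure.toMeasure_map] at h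
    exact h
  have i₂ : (μ : Measure (QuadConfig (univ : Set ℂ))).map (QuadConfig.mapHomeomorph g₂) = μ := by
    have h := congrArg FiniteMeasure.toMeasure (hScale μ hμ ‖c‖ hpos)
    rw [dilateLaw, FiniteMeasure.toMeasure_map] at h
    exact h
  have i₃ : (μ : Measure (QuadConfig (univ : Set ℂ))).map (QuadConfig.mapHomeomorph g₃) = μ := by
    have h := congrArg FiniteMeasure.toMeasure (hTrans μ hμ w)
    rw [FiniteMeasure.toMeasure_map] at h
    exact h
  have hcomp : QuadConfig.mapHomeomorph (similarity c hc w) =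
      QuadConfig.mapHomeomorph g₃ ∘ (QuadConfig.mapHomeomorph g₂ ∘ QuadConfig.mapHomeomorph g₁) := by
    funext S
    rw [hdecomp, QuadConfig.mapHomeomorph_trans, QuadConfig.mapHomeomorph_trans]
    rfl
  rw [hcomp, ← Measure.map_map (QuadConfig.measurable_mapHomeomorph g₃)
      ((QuadConfig.measurable_mapHomeomorph g₂).comp (QuadConfig.measurable_mapHomeomorph g₁)),
    ← Measure.map_map (QuadConfig.measurable_mapHomeomorph g₂)
      (QuadConfig.measurable_mapHomeomorph g₁), i₁, i₂, i₃]

/-- Similarity covariance of the decoded family `P D = (Ψ D)_* μ` from the invariance of `μ`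
under similarities and the equivariance of the decoder (a push-forward computation). -/
theorem isSimilarityCovariant_lawFamily (hRot : RotationInput) (hScale : ScaleInvariantLimits)
    (hTrans : ∀ μ ∈ subseqQuadLimits (univ : Set ℂ), ∀ w : ℂ, μ.map (QuadConfig.translate w) = μ)
    {Ψ : DobrushinDomain → QuadConfig (univ : Set ℂ) → CurveClass ℂ} (hΨ : IsTournamentTransfer Ψ)
    {μ : FiniteMeasure (QuadConfig (univ : Set ℂ))} (hμ : μ ∈ subseqQuadLimits (univ : Set ℂ)) :
    (lawFamily μ Ψ).IsSimilarityCovariant := by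
  intro D c hc w
  change (μ : Measure (QuadConfig (univ : Set ℂ))).map (Ψ (D.map (similarity c hc w))) =
    ((μ : Measure (QuadConfig (univ : Set ℂ))).map (Ψ D)).map
      (CurveClass.map (similarity c hc w : C(ℂ, ℂ)))
  rw [Measure.map_map (measurable_curveClassMap_similarity c hc w) (hΨ.measurable D)]
  have hfun : CurveClass.map (similarity c hc w : C(ℂ, ℂ)) ∘ Ψ D =
      Ψ (D.map (similarity c hc w)) ∘ QuadConfig.mapHomeomorph (similarity c hc w) :=
    funext fun S => (hΨ.equivariant D c hc w S).symm
  rw [hfun, ← Measure.map_map (hΨ.measurable _) (QuadConfig.measurable_mapHomeomorph _),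
    map_mapHomeomorph_similarity_eq hRot hScale hTrans hμ c hc w]

/-! ### Chordality, no tracing and convergence of the decoded family -/

/-- `P D = (Ψ D)_* μ` is chordal: a probability law (`μ` is one:
`isProbabilityMeasure_of_isSubseqQuadLimit`) carried by chordal curves of `D`. -/
theorem isChordal_lawFamily
    {Ψ : DobrushinDomain → QuadConfig (univ : Set ℂ) → CurveClass ℂ} (hΨ : IsTournamentTransfer Ψ)
    {μ : FiniteMeasure (QuadConfig (univ : Set ℂ))} (hμ : μ ∈ subseqQuadLimits (univ : Set ℂ)) :
    (lawFamily μ Ψ).IsChordal := by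
  intro D
  haveI : IsProbabilityMeasure (μ : Measure (QuadConfig (univ : Set ℂ))) :=
    isProbabilityMeasure_of_isSubseqQuadLimit isOpen_univ hμ
  refine ⟨Measure.isProbabilityMeasure_map (hΨ.measurable D).aemeasurable, ?_⟩
  filter_upwards [hΨ.chordal μ hμ D] with γ hγ
  exact hγ.1

/-- `P D` a.s. traces no boundary arc. -/
theorem noTrace_lawFamily
    {Ψ : DobrushinDomain → QuadConfig (univ : Set ℂ) → CurveClass ℂ} (hΨ : IsTournamentTransfer Ψ)
    {μ : FiniteMeasure (QuadConfig (univ : Set ℂ))} (hμ : μ ∈ subseqQuadLimits (univ : Set ℂ))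
    (D : DobrushinDomain) :
    ∀ᵐ γ ∂(lawFamily μ Ψ D), ∀ c : Curve ℂ, CurveClass.mk c = γ → ∀ s t : I, s < t →
      c '' Set.Icc s t ⊆ frontier D.carrier → (c '' Set.Icc s t).Subsingleton := by
  filter_upwards [hΨ.chordal μ hμ D] with γ hγ
  exact hγ.2

/-- Convergence of the interface laws to `P D` along the sequence on which the full-plane
quad-crossing laws converge (the marginal of `jointLimit`). -/
theorem tendsto_integral_lawFamily
    {Ψ : DobrushinDomain → QuadConfig (univ : Set ℂ) → CurveClass ℂ} (hΨ : IsTournamentTransfer Ψ)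
    {δs : ℕ → ℝ} {μ : FiniteMeasure (QuadConfig (univ : Set ℂ))} (hpos : ∀ n, 0 < δs n)
    (hlim : Tendsto δs atTop (𝓝 0)) (hconv : Tendsto (fun n => z2QuadLaw univ (δs n)) atTop (𝓝 μ))
    (D : DobrushinDomain) (E : ℝ → DiscreteDobrushin) (hE : ZdDiscretisationFamily D E)
    (f : CurveClass ℂ →ᵇ ℝ) :
    Tendsto (fun n => ∫ ω, f (bondInterfaceIn D (E (δs n)) ω) ∂(bondPercolation (zdGraph 2) half))
      atTop (𝓝 (∫ γ, f γ ∂(lawFamily μ Ψ D))) := by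
  have h := hΨ.jointLimit δs μ hpos hlim hconv D E hE (f.compContinuous ContinuousMap.snd)
  have hmap : ∫ γ, f γ ∂(lawFamily μ Ψ D) =
      ∫ S, f (Ψ D S) ∂(μ : Measure (QuadConfig (univ : Set ℂ))) :=
    integral_map (hΨ.measurable D).aemeasurable f.continuous.aestronglyMeasurable
  rw [hmap]
  -- `(f.compContinuous snd) (S, γ) = f γ` definitionally
  exact h

/-! ### The composition (concludes the crux BY NAME) -/

/-- **`LagHandOff` from the five registered stubs + the landed translation invariance.**  Clause (i) outright; for (ii): extract a subsequence on
which the full-plane laws converge to some `μ ∈ Λ` (`exists_quadLimit_subseq`), take a tournament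
transfer (Stubs 2, 3, 4 ⇒ 5) upgraded by Stub 6, and hand over `P := (Ψ ·)_* μ`: chordal and
non-tracing by `IsTournamentTransfer.chordal`, similarity covariant by the two antecedents + Stub 1,
Markov / local / target independent by Stub 6, with the convergence clause = the marginal of
`jointLimit`. -/
theorem LagHandOff_of : LagHandOff := by
  intro hRot hScale
  refine ⟨fun D E hE =>
    Summit.CriticalPhenomena.CardyFormulaZ2.Theorems.LagHandOff.Negative.lagHandOff_clause_i D E hE,
    fun δs hpos hlim => ?_⟩
  obtain ⟨φ, hφ, μ, hμ, hconv⟩ := exists_quadLimit_subseq δs hpos hlim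
  obtain ⟨Ψ₀, hΨ₀⟩ :=
    stub_tournamentTransfer quadContinuity tournamentRigidity limitCurveRegularity
  obtain ⟨Ψ, hΨ, hML⟩ := stub_markovLocality quadContinuity tournamentRigidity
    limitCurveRegularity Ψ₀ hΨ₀
  obtain ⟨hM, hL, hT⟩ := hML μ hμ
  refine ⟨φ, hφ, lawFamily μ Ψ,
    ⟨isChordal_lawFamily hΨ hμ,
      isSimilarityCovariant_lawFamily hRot hScale translationInvariance hΨ hμ, hM, hL, hT⟩,
    fun D => noTrace_lawFamily hΨ hμ D, fun D E hE f => ?_⟩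
  exact tendsto_integral_lawFamily hΨ (fun n => hpos (φ n)) (hlim.comp hφ.tendsto_atTop) hconv
    D E hE f

/-- The crux, by name (lead's closing theorem: sorry-free once every `stub_*` is replaced by its
landed helper; its type is literally the route decl). -/
theorem lagHandOff_proof :
    Summit.CriticalPhenomena.CardyFormulaZ2.Theses.CardySelfRefinement.LagHandOff :=
  LagHandOff_of

end Summit.CriticalPhenomena.CardyFormulaZ2.Cruxes.LagHandOff.HittingTournament

end
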